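import Summits.Ventures.HodgeRepro2.T5DualPairSwap
import Summits.Ventures.HodgeRepro2.T5WeightSpaces

/-!
# The partners of the trivial one-dimensional representation: `Hom(𝟙, σ ⊠ π) ≠ 0` iff `σ ⊠ π` has
# a non-zero invariant vector; for a character, iff `χ = 1`

Kernel support (seat p3, cell pub-hodge-repro2) behind row B3 of `route/T5-route-3.md` (the residue
(R2) at a non-split place with `β′_v ≠ 1`): «`Θ_χ(β′_v, 0-space) ≠ 0 ⟺ β′_v = 1` (`ω` for
`(U(V′), U(0))` is the trivial representation) [A, one line]», listed in §C among the one-line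
dictionaries. In file 34's vocabulary (`HasPartner ω σ π := ∃ f ≠ 0, f` intertwines `ω → σ ⊠ π`):

* `hasPartner_trivial_iff`: for the one-dimensional trivial representation `ω = 𝟙` of `G × H`,
  `HasPartner 𝟙 σ π` holds iff `σ ⊠ π` has a non-zero `(G × H)`-invariant vector (a linear map
  out of `k` is determined by the image of `1`);
* `charLinRep χ`: the one-dimensional (algebraic) representation of a character `χ : G →* kˣ`
  — for `k = ℂ` it is the linear map underlying p1's continuous `T5WeightSpaces.charRep χ`
  (`coe_charRep_eq_charLinRep`; different type, nothing re-declared);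
* `hasPartner_trivial_charLinRep_iff`: `HasPartner 𝟙 (charLinRep χ) 𝟙 ⟺ χ = 1` — the theta lift of a
  character `β′` of `G(W) = E¹_v` to the `0`-dimensional member of the tower is non-zero iff `β′`
  is trivial (`k ⊗ k` is a vector space: `(χ(g) − 1)·w = 0` with `w ≠ 0` forces `χ(g) = 1`).

What stays prose: that the Weil representation of the dual pair `(U(V′), U(0))` IS the trivial
one-dimensional representation (HKS (5.2) at `m = 0`, as printed) and the definition of `Θ_χ`
through `Hom`. Header declaration (README §8(d)): uses an L-value-free non-vanishing device: no.
-/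

namespace Summit.Ventures.HodgeRepro2.T5TrivialPartner

open T5DualPairSwap T5SplittingTwist TensorProduct

section General

variable {k : Type*} [CommSemiring k] {G H : Type*} [Monoid G] [Monoid H]
  {V₁ V₂ : Type*} [AddCommMonoid V₁] [Module k V₁] [AddCommMonoid V₂] [Module k V₂]

/-- A linear map out of `k` is `x ↦ x • f 1`. -/
theorem apply_eq_smul (f : k →ₗ[k] V₁ ⊗[k] V₂) (x : k) : f x = x • f 1 := by
  conv_lhs => rw [← mul_one x, ← smul_eq_mul, LinearMap.map_smul]

/-- A linear map out of `k` is non-zero iff its value at `1` is. -/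
theorem ne_zero_iff_apply_one_ne_zero (f : k →ₗ[k] V₁ ⊗[k] V₂) : f ≠ 0 ↔ f 1 ≠ 0 := by
  constructor
  · intro hf h1
    apply hf
    ext
    rw [h1, LinearMap.zero_apply]
  · intro h1 hf
    apply h1
    rw [hf, LinearMap.zero_apply]

/-- Intertwining `𝟙 → σ ⊠ π` for a map out of `k` means exactly that `f 1` is
`(G × H)`-invariant. -/
theorem isIntertwiningMap_trivial_iff (σ : Representation k G V₁) (π : Representation k H V₂)
    (f : k →ₗ[k] V₁ ⊗[k] V₂) :
    (Representation.trivial k (G × H) k).IsIntertwiningMap (extTprod σ π) f ↔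
      ∀ (g : G) (h : H), TensorProduct.map (σ g) (π h) (f 1) = f 1 := by
  constructor
  · intro hf g h
    have := hf.isIntertwining (g, h) 1
    rw [extTprod_apply, Representation.trivial_apply] at this
    exact this.symm
  · intro hf
    refine ⟨fun gh x => ?_⟩
    rw [extTprod_apply, Representation.trivial_apply, apply_eq_smul f x, LinearMap.map_smul,
      hf gh.1 gh.2]

/-- THE PARTNERS OF `𝟙`: `HasPartner 𝟙 σ π` iff `σ ⊠ π` has a non-zero invariant vector. -/
theorem hasPartner_trivial_iff (σ : Representation k G V₁) (π : Representation k H V₂) :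
    HasPartner (Representation.trivial k (G × H) k) σ π ↔
      ∃ w : V₁ ⊗[k] V₂, w ≠ 0 ∧ ∀ (g : G) (h : H), TensorProduct.map (σ g) (π h) w = w := by
  constructor
  · rintro ⟨f, hf0, hf⟩
    exact ⟨f 1, (ne_zero_iff_apply_one_ne_zero f).1 hf0,
      (isIntertwiningMap_trivial_iff σ π f).1 hf⟩
  · rintro ⟨w, hw0, hw⟩
    refine ⟨LinearMap.toSpanSingleton k _ w, ?_, ?_⟩
    · rw [ne_zero_iff_apply_one_ne_zero]
      simpa using hw0
    · rw [isIntertwiningMap_trivial_iff]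
      intro g h
      simpa using hw g h

end General

section Character

variable {k : Type*} [CommSemiring k] {G : Type*} [Monoid G]

/-- The one-dimensional representation of a character `χ : G →* kˣ`: `g` acts on `k` by
multiplication by `χ g`. -/
def charLinRep (χ : G →* kˣ) : Representation k G k where
  toFun g := (χ g : k) • LinearMap.id
  map_one' := by
    ext
    simp
  map_mul' g h := by
    ext
    simp [mul_comm]

/-- `charLinRep χ g x = χ g * x`. -/
theorem charLinRep_apply (χ : G →* kˣ) (g : G) (x : k) : charLinRep χ g x = (χ g : k) * x :=
  rfl

end Character

section CharacterPartner

variable {k : Type*} [Field k] {G H : Type*} [Monoid G] [Monoid H]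

/-- On `k ⊗ k`, `charLinRep χ g ⊗ 𝟙` is multiplication by `χ g`. -/
theorem map_charLinRep_trivial (χ : G →* kˣ) (g : G) (h : H) (w : k ⊗[k] k) :
    TensorProduct.map (charLinRep χ g) (Representation.trivial k H k h) w = (χ g : k) • w := by
  induction w using TensorProduct.induction_on with
  | zero => simp
  | tmul x y =>
    rw [TensorProduct.map_tmul, charLinRep_apply, Representation.trivial_apply, TensorProduct.smul_tmul',
      smul_eq_mul]
  | add x y hx hy => rw [map_add, hx, hy, smul_add]

/-- «`Θ_χ(β′_v, 0-space) ≠ 0 ⟺ β′_v = 1`»: the trivial one-dimensional representation of `G × H`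
has the pair `(χ, 𝟙)` as a partner iff the character `χ` is trivial. -/
theorem hasPartner_trivial_charLinRep_iff (χ : G →* kˣ) :
    HasPartner (Representation.trivial k (G × H) k) (charLinRep χ) (Representation.trivial k H k) ↔
      ∀ g : G, χ g = 1 := by
  rw [hasPartner_trivial_iff]
  constructor
  · rintro ⟨w, hw0, hw⟩ g
    have h1 := hw g 1
    rw [map_charLinRep_trivial] at h1
    have h2 : (χ g : k) • w = (1 : k) • w := by rw [h1, one_smul]
    exact Units.ext (smul_left_injective k hw0 h2)
  · intro hχ
    refine ⟨(1 : k) ⊗ₜ[k] (1 : k), ?_, fun g h => ?_⟩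
    · intro h0
      have := congrArg (TensorProduct.lid k k) h0
      rw [TensorProduct.lid_tmul, map_zero, smul_eq_mul, mul_one] at this
      exact one_ne_zero this
    · rw [map_charLinRep_trivial, hχ g, Units.val_one, one_smul]

/-- The same, read for a non-trivial character: no partner. -/
theorem not_hasPartner_trivial_charLinRep (χ : G →* kˣ) (hχ : ∃ g : G, χ g ≠ 1) :
    ¬ HasPartner (Representation.trivial k (G × H) k) (charLinRep χ) (Representation.trivial k H k) := by
  rw [hasPartner_trivial_charLinRep_iff]
  rintro h
  obtain ⟨g, hg⟩ := hχ
  exact hg (h g)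

end CharacterPartner

section Bridge

variable {K : Type*} [Group K]

/-- For `k = ℂ` the algebraic `charLinRep χ` is the linear map underlying p1's continuous
one-dimensional representation `T5WeightSpaces.charRep χ` (file T5WeightSpaces, p396919). -/
theorem coe_charRep_eq_charLinRep (χ : K →* ℂˣ) (g : K) :
    ((T5WeightSpaces.charRep χ g : ℂ →L[ℂ] ℂ) : ℂ →ₗ[ℂ] ℂ) = charLinRep χ g := by
  ext
  simp [T5WeightSpaces.charRep_apply, charLinRep_apply]

end Bridge

end Summit.Ventures.HodgeRepro2.T5TrivialPartner
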